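import Summits.RiemannHypothesis.RiemannHypothesis.Theorems.TiltedLandingLaw421R3K2NoZFloor

/-! # TiltedLandingLaw421 — R3 MASS–SIGN COUPLING, per-zero core (C1 IMAGE S v3; T2 of memo `Regime3prime-TARGET-v1.md`)

v3 = v2 with the six STATEMENTS byte-identical and `massSign_realZero` re-proved inside 40 000 heartbeats (director (CA844)(1): desk HB100k screen).

SUPPORT image for crux `TiltedLandingLaw421R` ⟨stmt-RiemannHypothesis-33346⟩, route EarlyAppointments.  One import (#1230 `…R3K2NoZFloor`, through it the
frame vocabulary).  §1 (K, PROVED, f-free) the PER-REAL-ZERO inequality of T2 with the sharp-in-the-limit constant 2: for a real zero `x`, a touching pair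
`v`, `z` (`0 < Im v ≤ Im z`, `|Re v − Re z| ≤ Im v + Im z`) and any point `u` of the segment `[v, z]`, the hull-mass contribution `Im u²/‖u − x‖²` is at most
twice the signed-gain contribution `Im v²/‖v − x‖² + Im z²/‖z − x‖²` (= `−Im v·Im (v−x)⁻¹ − Im z·Im (z−x)⁻¹`).  Written in real coordinates
`p = Re v − x`, `q = Re z − x`, `h = Im v`, `k = Im z`, `u = v + t(z − v)`.  Proof: if `|p| ≤ h` or `|q| ≤ k` one gain term is already `≥ 1/2 ≥ LHS/2`;
otherwise touching forces `p`, `q` to have the same sign and `Re u − x` over `Im u` is a convex combination of `p/h` and `q/k`, so the LHS is at most the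
larger gain term.  §2 (K, PROVED) the segment `[v, z]` of an ATOMIC pair carries no other upper zero of `f⁽ʲ⁾` (so the pair cofactor is zero-free there).
§3 (typed OPEN) `MassSignCouplingQ A`: on β-levels, for every pair cofactor `g` (`f⁽ʲ⁾ = (·−v)(·−v̄)(·−z)(·−z̄)·g`, `g` entire, `g v ≠ 0 ≠ g z`), along the segment
`Im u²·‖(g′/g)′(u)‖ ≤ A·(−Im v·Im (g′/g)(v) − Im z·Im (g′/g)(z))` — the f-side target T2 (per-zero cores: §1 for real zeros, constant 2; separated conjugate
pairs numerically ≤ 1.115, not proved here; summation over the zeros of the order-`< 2` cofactor as in `RhW08.NestedSign` / `RhW08.PairSign`).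
No `sorry`; RH is not proved; T2 / `HeavyMassNoZQ` / RUNG-P / ⟨33346⟩ OPEN. -/

namespace RhW08.MassSign

open RhIdea6.G17.W07C7.Rev6 (EngineHyps5)
open RhW08.TouchedDissipation (Touches AtomicPair)
open RhW08.PerturbativeRung (BetaLevel)

/-! ## §1 (K) The per-real-zero inequality, constant 2 -/

/-- §1 one gain term at least `1/2` when the zero is under the disc: `p² ≤ h²`, `0 < h` ⇒ `1/2 ≤ h²/(p² + h²)`. -/
theorem half_le_gain {p h : ℝ} (hh : 0 < h) (hp : p ^ 2 ≤ h ^ 2) : 1 / 2 ≤ h ^ 2 / (p ^ 2 + h ^ 2) := by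
  rw [div_le_div_iff₀ (by norm_num) (by positivity)]
  nlinarith

/-- §1 the mass term is at most `1`. -/
theorem mass_le_one {r m : ℝ} (hm : 0 < m) : m ^ 2 / (r ^ 2 + m ^ 2) ≤ 1 := by
  rw [div_le_one (by positivity)]
  nlinarith [sq_nonneg r]

/-- §1 comparison of two such terms: `0 < m`, `0 < h`, `m·|p| ≤ h·|r|`-in-squares ⇒ `m²/(r² + m²) ≤ h²/(p² + h²)`. -/
theorem mass_le_gain_of_sq {r m p h : ℝ} (hm : 0 < m) (hh : 0 < h) (hc : m ^ 2 * p ^ 2 ≤ h ^ 2 * r ^ 2) :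
    m ^ 2 / (r ^ 2 + m ^ 2) ≤ h ^ 2 / (p ^ 2 + h ^ 2) := by
  rw [div_le_div_iff₀ (by positivity) (by positivity)]
  nlinarith

/-- ★ §1 (K) **PER-REAL-ZERO MASS–SIGN INEQUALITY, constant 2.**  `0 < h ≤ k`, touching `|p − q| ≤ h + k`, `t ∈ [0, 1]`:
`((1−t)h + tk)² / (((1−t)p + tq)² + ((1−t)h + tk)²) ≤ 2·(h²/(p² + h²) + k²/(q² + k²))`. -/
theorem massSign_realZero {p q h k t : ℝ} (hh : 0 < h) (hk : h ≤ k) (htouch : |p - q| ≤ h + k) (ht0 : 0 ≤ t) (ht1 : t ≤ 1) :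
    ((1 - t) * h + t * k) ^ 2 / ((((1 - t) * p + t * q)) ^ 2 + ((1 - t) * h + t * k) ^ 2) ≤
      2 * (h ^ 2 / (p ^ 2 + h ^ 2) + k ^ 2 / (q ^ 2 + k ^ 2)) := by
  set m := (1 - t) * h + t * k with hm_def
  set r := (1 - t) * p + t * q with hr_def
  have hkpos : 0 < k := lt_of_lt_of_le hh hk
  have hm : 0 < m := by
    have e : m = h + t * (k - h) := by rw [hm_def]; ring
    have := mul_nonneg ht0 (sub_nonneg.2 hk)
    linarith
  have hgv : 0 ≤ h ^ 2 / (p ^ 2 + h ^ 2) := by positivity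
  have hgz : 0 ≤ k ^ 2 / (q ^ 2 + k ^ 2) := by positivity
  have hL1 : m ^ 2 / (r ^ 2 + m ^ 2) ≤ 1 := mass_le_one hm
  by_cases hp : p ^ 2 ≤ h ^ 2
  · have := half_le_gain hh hp
    linarith
  by_cases hq : q ^ 2 ≤ k ^ 2
  · have := half_le_gain hkpos hq
    linarith
  push Not at hp hq
  -- both zeros' feet outside the discs: `h < |p|`, `k < |q|`, and touching forces the same sign
  have hp' : h < |p| := by
    have := sq_lt_sq.mp hp
    rwa [abs_of_pos hh] at this
  have hq' : k < |q| := by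
    have := sq_lt_sq.mp hq
    rwa [abs_of_pos hkpos] at this
  -- the squared comparison from a signed one: `0 ≤ a ≤ b ⇒ a·a ≤ b·b`, in the shape `mass_le_gain_of_sq` wants
  have sqv : ∀ {a b : ℝ}, 0 ≤ m * a → m * a ≤ h * b → m ^ 2 * a ^ 2 ≤ h ^ 2 * b ^ 2 := by
    intro a b h0 hab
    have := mul_self_le_mul_self h0 hab
    have e1 : m ^ 2 * a ^ 2 = m * a * (m * a) := by ring
    have e2 : h ^ 2 * b ^ 2 = h * b * (h * b) := by ring
    rw [e1, e2]; exact this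
  have sqz : ∀ {a b : ℝ}, 0 ≤ m * a → m * a ≤ k * b → m ^ 2 * a ^ 2 ≤ k ^ 2 * b ^ 2 := by
    intro a b h0 hab
    have := mul_self_le_mul_self h0 hab
    have e1 : m ^ 2 * a ^ 2 = m * a * (m * a) := by ring
    have e2 : k ^ 2 * b ^ 2 = k * b * (k * b) := by ring
    rw [e1, e2]; exact this
  have ev : h * r - m * p = t * (q * h - p * k) := by rw [hm_def, hr_def]; ring
  have ez : k * r - m * q = (1 - t) * (p * k - q * h) := by rw [hm_def, hr_def]; ring
  have key : m ^ 2 / (r ^ 2 + m ^ 2) ≤ h ^ 2 / (p ^ 2 + h ^ 2) ∨ m ^ 2 / (r ^ 2 + m ^ 2) ≤ k ^ 2 / (q ^ 2 + k ^ 2) := by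
    rcases le_or_gt 0 p with hp0 | hp0 <;> rcases le_or_gt 0 q with hq0 | hq0
    · -- p > h, q > k
      rcases le_total (p * k) (q * h) with hpk | hpk
      · left
        refine mass_le_gain_of_sq hm hh (sqv (mul_nonneg hm.le hp0) ?_)
        have := mul_nonneg ht0 (sub_nonneg.2 hpk)
        linarith
      · right
        refine mass_le_gain_of_sq hm hkpos (sqz (mul_nonneg hm.le hq0) ?_)
        have := mul_nonneg (sub_nonneg.2 ht1) (sub_nonneg.2 hpk)
        linarith
    · -- p ≥ 0 > q: not touching
      exfalso
      rw [abs_of_nonneg hp0] at hp'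
      rw [abs_of_neg hq0] at hq'
      have : h + k < |p - q| := by
        rw [abs_of_pos (by linarith)]; linarith
      linarith
    · exfalso
      rw [abs_of_neg hp0] at hp'
      rw [abs_of_nonneg hq0] at hq'
      have : h + k < |p - q| := by
        rw [abs_of_neg (by linarith)]; linarith
      linarith
    · -- p < −h, q < −k: compare with `−p`, `−r`, `−q`
      have fl : m ^ 2 * p ^ 2 = m ^ 2 * (-p) ^ 2 := by ring
      have fr : h ^ 2 * r ^ 2 = h ^ 2 * (-r) ^ 2 := by ring
      have fq : m ^ 2 * q ^ 2 = m ^ 2 * (-q) ^ 2 := by ring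
      have fr' : k ^ 2 * r ^ 2 = k ^ 2 * (-r) ^ 2 := by ring
      rcases le_total (q * h) (p * k) with hpk | hpk
      · left
        refine mass_le_gain_of_sq hm hh ?_
        rw [fl, fr]
        refine sqv (mul_nonneg hm.le (by linarith)) ?_
        have := mul_nonneg ht0 (sub_nonneg.2 hpk)
        linarith
      · right
        refine mass_le_gain_of_sq hm hkpos ?_
        rw [fq, fr']
        refine sqz (mul_nonneg hm.le (by linarith)) ?_
        have := mul_nonneg (sub_nonneg.2 ht1) (sub_nonneg.2 hpk)
        linarith
  rcases key with h1 | h1 <;> linarith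

/-! ## §2 (K) The segment of an atomic pair carries no foreign upper zero -/

/-- ★ §2 (K) on a touching ATOMIC pair, a zero `u` of `f⁽ʲ⁾` with `0 < Im u` lying on the segment `[v, z]` is `v` or `z` (the two separation inequalities
of `AtomicPair` at `u = v + t(z − v)` add up to `Im u < 0`).  Hence the pair cofactor is zero-free on the segment. -/
theorem eq_or_eq_of_zero_on_segment {f : ℂ → ℂ} {j : ℕ} {v z : ℂ} (hv : 0 < v.im) (ht : Touches f j v z) (ha : AtomicPair f j v z)
    {t : ℝ} (ht0 : 0 ≤ t) (ht1 : t ≤ 1) (hu : iteratedDeriv j f (v + (t : ℂ) * (z - v)) = 0) :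
    v + (t : ℂ) * (z - v) = v ∨ v + (t : ℂ) * (z - v) = z := by
  by_contra hne
  push Not at hne
  set u := v + (t : ℂ) * (z - v) with hu_def
  have him : u.im = v.im + t * (z.im - v.im) := by simp [hu_def]
  have hre : u.re = v.re + t * (z.re - v.re) := by simp [hu_def]
  have hupos : 0 < u.im := by rw [him]; nlinarith [ht.2.1]
  obtain ⟨h1, h2⟩ := ha u hu hupos hne.1 hne.2
  have e1 : |v.re - u.re| = t * |z.re - v.re| := by
    rw [hre, show v.re - (v.re + t * (z.re - v.re)) = -(t * (z.re - v.re)) by ring, abs_neg, abs_mul, abs_of_nonneg ht0]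
  have e2 : |z.re - u.re| = (1 - t) * |z.re - v.re| := by
    rw [hre, show z.re - (v.re + t * (z.re - v.re)) = (1 - t) * (z.re - v.re) by ring, abs_mul, abs_of_nonneg (by linarith)]
  have htch : |z.re - v.re| ≤ v.im + z.im := by rw [abs_sub_comm]; exact ht.2.2
  rw [e1] at h1
  rw [e2] at h2
  have hD : 0 ≤ |z.re - v.re| := abs_nonneg _
  nlinarith [mul_le_mul_of_nonneg_left htch ht0, mul_le_mul_of_nonneg_left htch (show (0:ℝ) ≤ 1 - t by linarith)]

/-! ## §3 The f-side target T2, typed OPEN -/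

/-- ★ §3 (typed OPEN, substantive; regime 3′ analytic target T2 «MASS–SIGN COUPLING» with constant `A`) on every β-level of a frame, for every entire pair
cofactor `g` of the pair, along the segment `[v, z]` the hull mass is paid for by the signed gain at the two ends:
`Im u²·‖(g′/g)′(u)‖ ≤ A·(−Im v·Im (g′/g)(v) − Im z·Im (g′/g)(z))`.  Per-zero cores: §1 (real zeros, constant 2); separated conjugate pairs (numerically ≤ 1.24,
unproved); the genus factor of the order-`< 2` cofactor contributes to neither side.  BINDERS `g v ≠ 0`, `g z ≠ 0` (v2): the pair must be SIMPLE at both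
ends — `v` is (the floor forces `f⁽ʲ⁾′ v ≠ 0`), but NOTHING in `EngineHyps5`/`BetaLevel` makes the toucher `z` simple; at a multiple `z` the cofactor
vanishes at `z`, `(g′/g)′` blows up along the segment and the unbindered statement would be false.  (The same multiple-`z` pairs carry no light witness at
`z`, so they sit inside `HeavyMassNoZQ μ` for every `μ`: a separate sub-case of socket 3′ when composing — `childEnergy` excludes `z` itself by its
`f⁽ʲ⁾ u ≠ 0` clause, and the first-order drop at a double `z` doubles, so RUNG-P is not threatened there at first order.) -/
def MassSignCouplingQ (A : ℝ) : Prop :=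
  ∀ (η : ℝ) (f : ℂ → ℂ) (x₀ s hmax R Hs : ℝ) (B : ℕ), EngineHyps5 2 η f x₀ s hmax R Hs B →
    ∀ (j : ℕ) (v z : ℂ), BetaLevel η f x₀ s hmax R Hs B j v z →
    ∀ g : ℂ → ℂ, Differentiable ℂ g →
      (∀ u : ℂ, iteratedDeriv j f u = (u - v) * (u - (starRingEnd ℂ) v) * (u - z) * (u - (starRingEnd ℂ) z) * g u) →
      g v ≠ 0 → g z ≠ 0 →
      ∀ t : ℝ, 0 ≤ t → t ≤ 1 →
        (v + (t : ℂ) * (z - v)).im ^ 2 * ‖deriv (fun w => deriv g w / g w) (v + (t : ℂ) * (z - v))‖ ≤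
          A * (-(v.im * (deriv g v / g v).im) - z.im * (deriv g z / g z).im)

end RhW08.MassSign
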